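/-
Copyright (c) 2026 the pub-hodgecm-mathlib formalisation cell (harness21).  Prover seat hodgecm-mathlib-K2Liu-p02 (g7), Track B «K2-LIT» ∕ hLiu418
#184♮, #42S payer road (σ), V8-inst-A organ, V5-inst (f): the surjectivity letter `hsurj` of ★ p860598 `K2LiuA7ValueUnipotentPins.exists_leviRhoLoc_rhoLoc_eq`
(K2Liu-p09 (g6) 13:17:50Z «yours or ask me»; K2Liu-p02 (g7) claim 13:3xZ).  THEOREMS ONLY.
-/
import Summits.HodgeConjecture.HodgeConjecture.Theorems.K2LiuA7ValueInstanceDefs       -- ★ I-2 p860501 (`leviDeltaLoc`, `mem_leviDeltaLoc_iff`)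
import Literature.NumberTheory.GelbartRogawski1991.LocalDoubledUnitaryUnramifiedCell       -- ★ `isUnit_det_gramS'`
import HarnessLib

/-!
# Crux `HLiu418`, (σ) V5-inst (f): THE `D`-BLOCK MAP `M_Δ → GL_n(L ⊗ L⁺_v)` IS SURJECTIVE — every unit `D` is the `D`-block of a Siegel Levi element `m(D) = (S⁻¹ (D⁻¹)^{σᵀ} S, 0; 0, D)`

Cell `hodgecm-mathlib`, crux item hLiu418 = `stmt-HodgeConjecture-24832`; squad K2 ∕ K2Liu; prover K2Liu-p02 (g7).  THEOREMS ONLY (no `def`, no instance, no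
notation, no named-fact hypothesis, no `sorry`); lane `--supports stmt-HodgeConjecture-24832 --as helper`.

**`exists_mem_leviDeltaLoc_blkD_eq`**: for every `D ∈ GL_n(L ⊗ L⁺_v)` there is `m ∈ M_Δ` (★ I-2 `leviDeltaLoc`: `B(m) = C(m) = 0`) with `D(m) = D` — the element of `U(𝔻)(L⁺_v)` with ADAPTED matrix
`Y = (A, 0; 0, D)`, `A := S⁻¹ · ((D⁻¹)^σ)ᵀ · S`, `S = 2 T₀ ⊗ 1` (★ `ofAdapted`: `Y` preserves the adapted form `antidiag(S, S)` since `(A^σ)ᵀ S D = S D⁻¹ S⁻¹ S D = S` and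
`(D^σ)ᵀ S A = ((D⁻¹ D)^σ)ᵀ S = S`).  It discharges the binder `hsurj` of ★ `exists_leviRhoLoc_rhoLoc_eq` (`htrans` of ★ V8e `face_two_of_laws` at the instance ★ I-2).  Generic datum currency
`{T₀} (hT₀ : T₀.IsSymm) (hT₀d : IsUnit T₀.det) (hJD : hermD = (gramD T₀).map _)` as ★ I-2 `isSiegelDelta_of_mem_leviDeltaLoc` (instantiate with ★ `gramR_isSymm`, ★ `hermD_eq_map_gramD`).
References: [Kudla1994] §3; [HarrisKudlaSweet1996] §1 (1.11); [MoeglinVignerasWaldspurger1987] Chap. 1 I.17.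
HONEST LABEL.  Count-neutral helper: `HC_CM` is proved only modulo the 7 printed citations (2 remaining named inputs: hLiu418 = `stmt-HodgeConjecture-24832`,
h413 = `stmt-HodgeConjecture-24833`) until rung 0 closes.
-/

set_option autoImplicit false
set_option linter.dupNamespace false -- the mandated namespace repeats `HodgeConjecture.HodgeConjecture`

noncomputable section

open scoped Matrix
open NumberField IsDedekindDomain Matrix
open Literature.NumberTheory.Automorphic Literature.NumberTheory.Automorphic.UnitaryGroup
open Literature.NumberTheory.GelbartRogawski1991 Literature.NumberTheory.GelbartRogawski1991.GRConstruction
open Literature.NumberTheory.GelbartRogawski1991.UnitaryDualPair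
open Literature.NumberTheory.GelbartRogawski1991.UnitaryDualPair.LocalSplitting
open Literature.NumberTheory.GelbartRogawski1991.AdaptedBlocks
open Literature.NumberTheory.K2Lit.SiegelDoubled
open Summit.HodgeConjecture.HodgeConjecture.Cruxes.HLiu418.K2LiuA7ValueInstanceDefs

namespace Summit.HodgeConjecture.HodgeConjecture.Cruxes.HLiu418.K2LiuLeviDeltaBlockDSurjective

variable (L : Type) [Field L] [NumberField L] [IsCMField L] [Algebra.IsQuadraticExtension (Fp L) L]
  {δ : L} (hcδ : IsCMField.complexConj L δ = -δ) (hδ : δ ≠ 0) {d : Fp L} (hd : δ * δ = algebraMap (Fp L) L d)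
variable {N M n : ℕ} (e : Fin N × Fin M ≃ Fin n)
  (dV : Fin N → L) (hdV : ∀ i, IsCMField.complexConj L (dV i) = dV i)
  (dW : Fin M → L) (hdW : ∀ i, IsCMField.complexConj L (dW i) = dW i)
variable (v : HeightOneSpectrum (𝓞 (Fp L)))
  {T₀ : Matrix (Fin n) (Fin n) (Fp L)} (hT₀ : T₀.IsSymm) (hT₀d : IsUnit T₀.det)
  (hJD : hermD L e dV hdV dW hdW = (gramD (Fp L) n T₀).map (algebraMap (Fp L) L))

omit [Algebra.IsQuadraticExtension (Fp L) L] in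
/-- `σ = c ⊗ 1` commutes with matrix inversion: `(S⁻¹)^σ = (S^σ)⁻¹`, here for a `σ`-fixed invertible `S`: `(S⁻¹)^σ = S⁻¹`. [folklore] -/
theorem map_conjLocal_nonsing_inv_of_map_eq {S : Matrix (Fin n) (Fin n) (LocalRing L v)} (hS : S.map (conjLocal L (IsCMField.complexConj L) v) = S)
    (hSu : IsUnit S.det) : S⁻¹.map (conjLocal L (IsCMField.complexConj L) v) = S⁻¹ := by
  have h : S⁻¹.map (conjLocal L (IsCMField.complexConj L) v) * S = 1 := by
    calc S⁻¹.map (conjLocal L (IsCMField.complexConj L) v) * S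
        = S⁻¹.map (conjLocal L (IsCMField.complexConj L) v) * S.map (conjLocal L (IsCMField.complexConj L) v) := by rw [hS]
      _ = (S⁻¹ * S).map (conjLocal L (IsCMField.complexConj L) v) := Matrix.map_mul.symm
      _ = 1 := by rw [Matrix.nonsing_inv_mul _ hSu, Matrix.map_one _ (map_zero _) (map_one _)]
  exact (Matrix.inv_eq_left_inv h).symm

set_option maxHeartbeats 1600000 in -- measured: the `M_Δ`∕`localPi` subgroup coercions over `L ⊗ L⁺_v` unfold slowly (as ★ I-2 `leviBlkDHom`, 400000 there)
include hcδ hδ hd hT₀ hT₀d hJD in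
/-- **THE `D`-BLOCK MAP `M_Δ → GL_n(L ⊗ L⁺_v)` IS SURJECTIVE**: every `D ∈ GL_n(L ⊗ L⁺_v)` is `D(m)` for the Siegel Levi element `m` with adapted matrix
`(S⁻¹ ((D⁻¹)^σ)ᵀ S, 0; 0, D)`, `S = 2 T₀ ⊗ 1` (★ `ofAdapted`) — the `hsurj` binder of ★ `K2LiuA7ValueUnipotentPins.exists_leviRhoLoc_rhoLoc_eq`. [cite: Kudla1994, §3]
[cite: HarrisKudlaSweet1996, §1 (1.11)] -/
theorem exists_mem_leviDeltaLoc_blkD_eq (D : GL (Fin n) (LocalRing L v)) :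
    ∃ m : ↥(leviDeltaLoc L e dV hdV dW hdW v),
      blkD (matA (Fp L) L (IsCMField.complexConj L) v n (m : UnitaryGroup.localPi L (IsCMField.complexConj L) (n + n) (hermD L e dV hdV dW hdW) v)) = D.val := by
  -- the form block `S = 2 T₀ ⊗ 1`: symmetric, `σ`-fixed, invertible
  set σ := conjLocal L (IsCMField.complexConj L) v with hσ
  set S : Matrix (Fin n) (Fin n) (LocalRing L v) := (2 : LocalRing L v) • gramS (Fp L) L v n T₀ with hSdef
  have h2 : IsUnit (2 : LocalRing L v) := by
    have h := (IsUnit.mk0 (2 : v.adicCompletion (Fp L)) two_ne_zero).map (toLocalRing L v)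
    rwa [map_ofNat] at h
  have hSu : IsUnit S.det := by
    rw [hSdef, Matrix.det_smul, Fintype.card_fin]
    exact (h2.pow _).mul (isUnit_det_gramS' (Fp L) L v n hT₀d)
  have hSσ : S.map σ = S := by
    rw [hSdef, Matrix.map_smul' _ _ _ (map_mul σ), map_ofNat, gramS_map_conj]
  have hST : Sᵀ = S := by rw [hSdef, Matrix.transpose_smul, gramS_transpose (Fp L) L v n hT₀]
  have hSinvσ : S⁻¹.map σ = S⁻¹ := map_conjLocal_nonsing_inv_of_map_eq L v hSσ hSu
  have hSinvT : S⁻¹ᵀ = S⁻¹ := by rw [Matrix.transpose_nonsing_inv, hST]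
  have hσσ : ∀ X : Matrix (Fin n) (Fin n) (LocalRing L v), (X.map σ).map σ = X := fun X =>
    Matrix.ext fun i j => conjLocal_conjLocal' (Fp L) L (IsCMField.complexConj L) hcδ hδ hd v (X i j)
  -- the blocks
  set Dm : Matrix (Fin n) (Fin n) (LocalRing L v) := D.val with hDm
  set Di : Matrix (Fin n) (Fin n) (LocalRing L v) := (D⁻¹ : GL (Fin n) (LocalRing L v)).val with hDi
  have hDiD : Di * Dm = 1 := by rw [hDi, hDm, ← Units.val_mul, inv_mul_cancel, Units.val_one]
  have hDDi : Dm * Di = 1 := by rw [hDi, hDm, ← Units.val_mul, mul_inv_cancel, Units.val_one]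
  set A : Matrix (Fin n) (Fin n) (LocalRing L v) := S⁻¹ * (Di.map σ)ᵀ * S with hA
  -- `(A^σ)ᵀ = S · D⁻¹ · S⁻¹`
  have hAσT : (A.map σ)ᵀ = S * Di * S⁻¹ := by
    rw [hA, Matrix.map_mul, Matrix.map_mul, hSinvσ, hSσ, ← Matrix.transpose_map, hσσ, Matrix.transpose_mul, Matrix.transpose_mul,
      Matrix.transpose_transpose, hST, hSinvT, Matrix.mul_assoc]
  set Y : Matrix (Fin n ⊕ Fin n) (Fin n ⊕ Fin n) (LocalRing L v) := Matrix.fromBlocks A 0 0 Dm with hY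
  have hAu : IsUnit A.det := by
    rw [hA, Matrix.det_mul, Matrix.det_mul, Matrix.det_transpose, ← RingHom.mapMatrix_apply, ← RingHom.map_det]
    exact ((Matrix.isUnit_nonsing_inv_det _ hSu).mul ((Matrix.isUnits_det_units (D⁻¹)).map _)).mul hSu
  have hYu : IsUnit Y.det := by
    rw [hY, Matrix.det_fromBlocks_zero₂₁]
    exact hAu.mul (Matrix.isUnits_det_units D)
  have hYform : (Y.map σ)ᵀ * adForm (Fp L) L v n (T₀ := T₀) * Y = adForm (Fp L) L v n (T₀ := T₀) := by
    have had : adForm (Fp L) L v n (T₀ := T₀) = Matrix.fromBlocks 0 S S 0 := rfl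
    rw [had, hY, Matrix.fromBlocks_map, Matrix.fromBlocks_transpose, Matrix.fromBlocks_multiply, Matrix.fromBlocks_multiply]
    simp only [Matrix.map_zero _ (map_zero σ), Matrix.transpose_zero, Matrix.zero_mul, Matrix.mul_zero, add_zero, zero_add]
    rw [hAσT]
    congr 1
    · -- `S D⁻¹ S⁻¹ · S · D = S`
      rw [Matrix.mul_assoc (S * Di), Matrix.nonsing_inv_mul _ hSu, Matrix.mul_one, Matrix.mul_assoc, hDiD, Matrix.mul_one]
    · -- `(D^σ)ᵀ · S · (S⁻¹ (D⁻¹)^{σᵀ} S) = S`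
      rw [hA, ← Matrix.mul_assoc, ← Matrix.mul_assoc, Matrix.mul_assoc ((Dm.map σ)ᵀ) S S⁻¹, Matrix.mul_nonsing_inv _ hSu, Matrix.mul_one,
        ← Matrix.transpose_mul, ← Matrix.map_mul, hDiD, Matrix.map_one _ (map_zero σ) (map_one σ), Matrix.transpose_one, Matrix.one_mul]
  -- the element and its blocks
  set m := ofAdapted (Fp L) L (IsCMField.complexConj L) v n hJD Y hYu hYform with hm
  have hblocks := adapt_matA_ofAdapted (Fp L) L (IsCMField.complexConj L) v n hJD Y hYu hYform
  rw [adapt_eq] at hblocks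
  obtain ⟨-, hB, hC, hDD⟩ := Matrix.fromBlocks_inj.1 (hblocks.trans hY)
  exact ⟨⟨m, (mem_leviDeltaLoc_iff L e dV hdV dW hdW v m).2 ⟨hB, hC⟩⟩, hDD⟩

end Summit.HodgeConjecture.HodgeConjecture.Cruxes.HLiu418.K2LiuLeviDeltaBlockDSurjective

end
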